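import Summits.ValiantsHypothesis.ValiantsHypothesis.Theses.BorderApolarity
import Summits.ValiantsHypothesis.ValiantsHypothesis.Theses.GCTMult
import Summits.ValiantsHypothesis.ValiantsHypothesis.Theorems.BorderApolarityFixedWitnessObstructionQPFromGctThesis
import Summits.ValiantsHypothesis.ValiantsHypothesis.Theorems.BorderApolarityBorelFixedBorderApolarity
import Summits.ValiantsHypothesis.ValiantsHypothesis.Theorems.ToricFixedPoints.Negative.WithoutUpperLimitFalse

/-!
# Crux `FixedWitnessObstructionQP` (stmt-ValiantsHypothesis-5778): the unconditional status map

Kernel-checked bookkeeping for the line leads of crux stmt-5778 (route `BorderApolarity`), closing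
the conditional sandwich of `…QPFromGctThesis.lean` now that the support item
`BorelFixedBorderApolarity` (stmt-5781) is PROVED
(`BorderApolarityBorelFixedBorderApolarity.BorelFixedBorderApolarity_proof`):

* `fixedWitnessObstructionQP_iff_gctThesis` — **`FixedWitnessObstructionQP ↔ GCTMult.GctThesis`**
  with NO hypothesis: the crux is, verbatim up to the two proved support items, the
  quasi-polynomial Mulmuley–Sohoni thesis (crux stmt-0323 of route `GCTMult`).
* `toricWitnessObstructionQP_of_fixedWitnessObstructionQP` — the crux implies its toric child
  `ToricWitnessObstructionQP` (stmt-14753): toric curves `u·diag((t+2)^w)·g·det_m` lie in `GL·det_m`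
  (`ToricFixedPoints.Negative.toricCurve_mem_glOrbit`).
* `fixedWitnessObstructionQP_iff_toricWitnessObstructionQP` — given `ToricFixedPoints` (stmt-5779) the
  crux and its toric child are EQUIVALENT (the `←` direction is the glue `ToricReduction`,
  stmt-14757, re-derived inline), hence `toricWitnessObstructionQP_iff_gctThesis`: given
  `ToricFixedPoints`, stmt-14753 ↔ stmt-0323 too.

So every decl of this crux's two-layer plan is pinned to the one external open problem
`GCTMult.GctThesis`; nothing here is new mathematics.
-/

namespace Summit.ValiantsHypothesis.ValiantsHypothesis.Theorems.BorderApolarityFixedWitnessObstructionQP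

open Literature.Computability.AlgebraicComplexity
open Summit.ValiantsHypothesis.ValiantsHypothesis.Theses
open Summit.ValiantsHypothesis.ValiantsHypothesis.Theses.BorderApolarity

/-- **The crux is the quasi-polynomial Mulmuley–Sohoni thesis**, unconditionally:
`FixedWitnessObstructionQP ↔ GCTMult.GctThesis` (the conditional sandwich
`FixedWitnessObstructionQP_iff_gctThesis` fed with the proved support item
`BorelFixedBorderApolarity_proof`). [folklore] -/
theorem fixedWitnessObstructionQP_iff_gctThesis :
    FixedWitnessObstructionQP ↔ GCTMult.GctThesis :=
  FixedWitnessObstructionQP_iff_gctThesis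
    BorderApolarityBorelFixedBorderApolarity.BorelFixedBorderApolarity_proof

/-- Hence the crux implies the thesis with no hypothesis. [folklore] -/
theorem gctThesis_of_fixedWitnessObstructionQP (hX : FixedWitnessObstructionQP) :
    GCTMult.GctThesis :=
  fixedWitnessObstructionQP_iff_gctThesis.mp hX

/-- **The crux implies its toric child** `ToricWitnessObstructionQP` (stmt-14753): a toric witness
`(u, g, w, J)` is a witness `(Q, J)` with `Q_t = u·diag((t+2)^w)·g·det_m ∈ GL·det_m`
(`toricCurve_mem_glOrbit`); the
Kuratowski, `H₀`-stability and apolarity clauses are verbatim. [folklore] -/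
theorem toricWitnessObstructionQP_of_fixedWitnessObstructionQP (hX : FixedWitnessObstructionQP) :
    ToricWitnessObstructionQP := by
  intro c
  obtain ⟨n₀, hn₀⟩ := hX c
  refine ⟨n₀, ?_⟩
  intro n hn m inst hnm hm
  have hWn := @hn₀ n hn m inst hnm hm
  simp only [] at hWn ⊢
  rintro ⟨u, g, w, J, hlo, hup, hstab, hpp⟩
  exact hWn ⟨_, J,
    fun t => Summit.ValiantsHypothesis.Cruxes.ToricFixedPoints.Negative.toricCurve_mem_glOrbit u g w t,
    hlo, hup, hstab, hpp⟩

/-- The glue `ToricReduction` (stmt-14757) re-derived inline: `ToricFixedPoints` turns any witness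
into a toric one with the same `J` (threshold `max n₀ 3`). Same term as
`Summit.ValiantsHypothesis.ValiantsHypothesis.Theorems.toricReduction_proof`. [folklore] -/
theorem fixedWitnessObstructionQP_of_toric (hT : ToricFixedPoints)
    (hW : ToricWitnessObstructionQP) : FixedWitnessObstructionQP := by
  intro c
  obtain ⟨n₀, hn₀⟩ := hW c
  refine ⟨max n₀ 3, ?_⟩
  intro n hn m inst hnm hm
  have h3n : 3 ≤ n := le_trans (le_max_right n₀ 3) hn
  have hn' : n ≥ n₀ := le_trans (le_max_left n₀ 3) hn
  have hWn := @hn₀ n hn' m inst hnm hm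
  have hTn := @hT n m inst h3n hnm
  simp only [] at hWn hTn ⊢
  rintro ⟨P, J, hP, hlo, hup, hstab, hpp⟩
  obtain ⟨u, g, w, hQ⟩ := hTn P J hP ⟨hlo, hup⟩ hstab
  exact hWn ⟨u, g, w, J, hQ.1, hQ.2, hstab, hpp⟩

/-- Given the structural crux `ToricFixedPoints` (stmt-5779), the crux and its toric child are
EQUIVALENT. [folklore] -/
theorem fixedWitnessObstructionQP_iff_toricWitnessObstructionQP (hT : ToricFixedPoints) :
    FixedWitnessObstructionQP ↔ ToricWitnessObstructionQP :=
  ⟨toricWitnessObstructionQP_of_fixedWitnessObstructionQP, fixedWitnessObstructionQP_of_toric hT⟩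

/-- The thesis implies the toric child with no hypothesis. [folklore] -/
theorem toricWitnessObstructionQP_of_gctThesis (hG : GCTMult.GctThesis) :
    ToricWitnessObstructionQP :=
  toricWitnessObstructionQP_of_fixedWitnessObstructionQP (FixedWitnessObstructionQP_of_gctThesis hG)

/-- Given `ToricFixedPoints` (stmt-5779), the toric child `ToricWitnessObstructionQP` (stmt-14753) is
likewise EQUIVALENT to `GCTMult.GctThesis` (stmt-0323). [folklore] -/
theorem toricWitnessObstructionQP_iff_gctThesis (hT : ToricFixedPoints) :
    ToricWitnessObstructionQP ↔ GCTMult.GctThesis :=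
  (fixedWitnessObstructionQP_iff_toricWitnessObstructionQP hT).symm.trans
    fixedWitnessObstructionQP_iff_gctThesis

end Summit.ValiantsHypothesis.ValiantsHypothesis.Theorems.BorderApolarityFixedWitnessObstructionQP
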